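import Summits.CriticalPhenomena.SAWScalingLimit.Theorems.HexTight.Negative.RingDomain

/-!
# `OneScaleDive` off criticality, part 1: lattice potentials, chains, the length bound, chain codes
(negative lemma for crux `HexTight`, stmt-CriticalPhenomena-5423, line `reversal-virgin-disc`, stub 2)

drefute generation 2 (refuter, 2026-08-16). Main file and discussion:
`Negative/OneScaleDiveSubcritical.lean` (`not_oneScaleDiveAt_of_le`). This part is pure honeycomb
combinatorics over the faces `U i j`, `D i j` of `Negative/LatticeG2Defs.lean` and the coordinates `cA = 2 Re c`,
`cB = (6/√3) Im c` of `Negative/RingDomain.lean`: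
* the six lattice steps in the coordinates `(cA, cB)` (`adj_delta`); the potentials `3cA ∓ cB` drop by `≤ 4` along an
  edge and by `≤ 6` along two consecutive edges (`pA_pair`, `pB_pair`), hence by `≤ 3s+1` along a chain of `s` steps
  (`chain_drop_le`);
* `cA` moves by `≤ 1` per step, so a chain from `cA > 0` to `cA < 0` passes a cell with `cA = 0` (`exists_cA_eq_zero`);
* **`length_ge_of_far`**: a chain `U(M,0) → U(-M-1,0)` whose cells on the imaginary axis have `cB² ≥ 3M²+3M+2`
  (= "do not dive to `N_M/2`") has at least `5M+3` cells;
* `nb`/`idx`/`code`/`decode`: a lattice chain is determined by its first cell and the list of neighbour indices of its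
  steps (`decode_code`) — the `3^{n-1}` counting of part 2.
-/

noncomputable section

open scoped BigOperators
open Classical
open Literature.Probability.LatticeModels Literature.Probability.RandomPlanarGeometry
  Literature.Probability.RandomPlanarGeometry.SAW

namespace Summit.CriticalPhenomena.SAWScalingLimit.Cruxes.HexTight.Negative.Subcritical

/-! ## Face bookkeeping: coordinates, the three neighbours, three lattice potentials -/

/-- every face is `U i j` or `D i j` -/
theorem face_cases (a : HexVertex) : ∃ i j : ℤ, a = U i j ∨ a = D i j :=
  ⟨a.1 0, a.1 1, face_eq a⟩

/-- face type: `0` for an up face, `1` for a down face -/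
def tF (v : HexVertex) : ℤ := ((v.2 : ℕ) : ℤ)

/-- `tF` on an up face -/
@[simp] theorem tF_U (i j : ℤ) : tF (U i j) = 0 := by simp [tF, U]
/-- `tF` on a down face -/
@[simp] theorem tF_D (i j : ℤ) : tF (D i j) = 1 := by simp [tF, D]
/-- `cA = 2 Re c` on an up face -/
@[simp] theorem cA_U (i j : ℤ) : cA (U i j) = 2 * i + j + 1 := by simp [cA, U]
/-- `cA = 2 Re c` on a down face -/
@[simp] theorem cA_D (i j : ℤ) : cA (D i j) = 2 * i + j + 2 := by simp [cA, D]; ring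
/-- `cB = (6/√3) Im c` on an up face -/
@[simp] theorem cB_U (i j : ℤ) : cB (U i j) = 3 * j + 1 := by simp [cB, U]
/-- `cB = (6/√3) Im c` on a down face -/
@[simp] theorem cB_D (i j : ℤ) : cB (D i j) = 3 * j + 2 := by simp [cB, D]; ring

/-- **the six lattice steps in the coordinates `(cA, cB)`**: from an up face `(+1,+1)`, `(-1,+1)`, `(0,-2)`; from a
down face the opposite vectors. -/
theorem adj_delta {a b : HexVertex} (hab : hexGraph.Adj a b) :
    (tF a = 0 ∧ tF b = 1 ∧ (cA b = cA a + 1 ∧ cB b = cB a + 1 ∨ cA b = cA a - 1 ∧ cB b = cB a + 1 ∨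
      cA b = cA a ∧ cB b = cB a - 2)) ∨
    (tF a = 1 ∧ tF b = 0 ∧ (cA b = cA a - 1 ∧ cB b = cB a - 1 ∨ cA b = cA a + 1 ∧ cB b = cB a - 1 ∨
      cA b = cA a ∧ cB b = cB a + 2)) := by
  obtain ⟨i, j, rfl | rfl⟩ := face_cases a
  · rcases adj_U_iff.1 hab with rfl | rfl | rfl
    · simp only [tF_U, tF_D, cA_U, cA_D, cB_U, cB_D, true_and]; omega
    · simp only [tF_U, tF_D, cA_U, cA_D, cB_U, cB_D, true_and]; omega
    · simp only [tF_U, tF_D, cA_U, cA_D, cB_U, cB_D, true_and]; omega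
  · rcases adj_D_iff.1 hab with rfl | rfl | rfl
    · simp only [tF_U, tF_D, cA_U, cA_D, cB_U, cB_D, true_and]; omega
    · simp only [tF_U, tF_D, cA_U, cA_D, cB_U, cB_D, true_and]; omega
    · simp only [tF_U, tF_D, cA_U, cA_D, cB_U, cB_D, true_and]; omega

/-- the potential `3 cA - cB` (`= 2(3i+k) + 2`) drops by at most `4` along a lattice edge -/
theorem pA_step {a b : HexVertex} (hab : hexGraph.Adj a b) :
    3 * cA a - cB a ≤ 3 * cA b - cB b + 4 := by
  have := adj_delta hab; omega

/-- `3 cA - cB` drops by at most `6` along two consecutive lattice edges (a U-turn drops `0`) -/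
theorem pA_pair {a b c : HexVertex} (hab : hexGraph.Adj a b) (hbc : hexGraph.Adj b c) :
    3 * cA a - cB a ≤ 3 * cA c - cB c + 6 := by
  have := adj_delta hab; have := adj_delta hbc; omega

/-- the potential `3 cA + cB` (`= 2(3(i+j)+2k) + 4`) drops by at most `4` along a lattice edge -/
theorem pB_step {a b : HexVertex} (hab : hexGraph.Adj a b) :
    3 * cA a + cB a ≤ 3 * cA b + cB b + 4 := by
  have := adj_delta hab; omega

/-- `3 cA + cB` drops by at most `6` along two consecutive lattice edges -/
theorem pB_pair {a b c : HexVertex} (hab : hexGraph.Adj a b) (hbc : hexGraph.Adj b c) :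
    3 * cA a + cB a ≤ 3 * cA c + cB c + 6 := by
  have := adj_delta hab; have := adj_delta hbc; omega

/-- `cA` moves by at most `1` along a lattice edge -/
theorem cA_step {a b : HexVertex} (hab : hexGraph.Adj a b) : cA a ≤ cA b + 1 ∧ cA b ≤ cA a + 1 := by
  have := adj_delta hab; omega

/-- `12 ‖c(v)‖² = 3 cA² + cB²` -/
theorem norm_sq_hexCenter (v : HexVertex) :
    ‖hexCenter v‖ ^ 2 = ((3 * cA v ^ 2 + cB v ^ 2 : ℤ) : ℝ) / 12 := by
  rw [Complex.sq_norm, Complex.normSq_apply, re_eq_cA, im_eq_cB]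
  have h3 : Real.sqrt 3 * Real.sqrt 3 = 3 := Real.mul_self_sqrt (by norm_num)
  push_cast
  nlinarith [h3]

/-! ## Chains: the potential bound and the discrete intermediate value property -/

/-- along a lattice chain with `s` steps a potential with step drop `≤ 4` and two-step drop `≤ 6` drops
by at most `3s+1` -/
theorem chain_drop_le (p : HexVertex → ℤ) (h1 : ∀ a b, hexGraph.Adj a b → p a ≤ p b + 4)
    (h2 : ∀ a b c, hexGraph.Adj a b → hexGraph.Adj b c → p a ≤ p c + 6) :
    ∀ (n : ℕ) (a : HexVertex) (l : List HexVertex), l.length ≤ n → (a :: l).IsChain hexGraph.Adj →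
      p a - p ((a :: l).getLast (List.cons_ne_nil a l)) ≤ 3 * (l.length : ℤ) + 1 := by
  intro n
  induction n with
  | zero =>
    intro a l hl _
    have : l = [] := List.eq_nil_of_length_eq_zero (Nat.le_zero.1 hl)
    subst this
    simp
  | succ n ih =>
    intro a l hl hc
    match l, hl, hc with
    | [], _, _ => simp
    | [b], _, hc =>
      have hab : hexGraph.Adj a b := (List.isChain_cons_cons.1 hc).1
      have := h1 a b hab
      simp only [List.getLast_cons_cons, List.getLast_singleton, List.length_singleton]
      push_cast
      linarith
    | b :: c :: l', hl, hc =>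
      have hab : hexGraph.Adj a b := (List.isChain_cons_cons.1 hc).1
      have hc' := (List.isChain_cons_cons.1 hc).2
      have hbc : hexGraph.Adj b c := (List.isChain_cons_cons.1 hc').1
      have hc'' := (List.isChain_cons_cons.1 hc').2
      have hlen : l'.length ≤ n := by simp at hl; omega
      have key := ih c l' hlen hc''
      have h3 := h2 a b c hab hbc
      rw [List.getLast_cons_cons, List.getLast_cons_cons]
      simp only [List.length_cons]
      push_cast
      linarith

/-- the potential bound for a nonempty chain, in terms of `head`/`getLast`/`length` -/
theorem chain_drop_le' (p : HexVertex → ℤ) (h1 : ∀ a b, hexGraph.Adj a b → p a ≤ p b + 4)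
    (h2 : ∀ a b c, hexGraph.Adj a b → hexGraph.Adj b c → p a ≤ p c + 6)
    (m : List HexVertex) (hm : m ≠ []) (hc : m.IsChain hexGraph.Adj) :
    p (m.head hm) - p (m.getLast hm) + 2 ≤ 3 * (m.length : ℤ) := by
  obtain ⟨a, l, rfl⟩ := List.exists_cons_of_ne_nil hm
  have := chain_drop_le p h1 h2 l.length a l le_rfl hc
  simp only [List.head_cons, List.length_cons]
  push_cast
  linarith

/-- discrete intermediate value property of `cA = 2 Re c(·)` (it moves by `≤ 1` per step) -/
theorem exists_cA_eq_zero : ∀ (l : List HexVertex) (a : HexVertex), (a :: l).IsChain hexGraph.Adj →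
    0 ≤ cA a → cA ((a :: l).getLast (List.cons_ne_nil a l)) ≤ 0 → ∃ P ∈ a :: l, cA P = 0 := by
  intro l
  induction l with
  | nil =>
    intro a _ h0 h1
    exact ⟨a, by simp, le_antisymm (by simpa using h1) h0⟩
  | cons b l ih =>
    intro a hc h0 h1
    by_cases ha : cA a = 0
    · exact ⟨a, by simp, ha⟩
    · have hab : hexGraph.Adj a b := (List.isChain_cons_cons.1 hc).1
      have hb : 0 ≤ cA b := by have := (cA_step hab).1; omega
      rw [List.getLast_cons_cons] at h1
      obtain ⟨P, hP, hP0⟩ := ih b (List.isChain_cons_cons.1 hc).2 hb h1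
      exact ⟨P, List.mem_cons_of_mem a hP, hP0⟩

/-! ## The length bound for non-diving chains between the antipodal doors -/

/-- **Non-diving chains are long.** A lattice chain from `U(M,0)` to `U(-M-1,0)` whose cells `P` on the
imaginary axis (`cA P = 0`) satisfy `cB(P)² ≥ 3M² + 3M + 2` (i.e. `‖c(P)‖ > N_M/2`) has `≥ 5M+3` cells:
it passes such a `P` (`exists_cA_eq_zero`); towards `P` the potential `3cA ∓ cB` falls by `6M+2+|cB P|`,
after `P` the potential `3cA ± cB` falls by as much, each at rate `≤ 3` per cell (`chain_drop_le'`), and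
`2|cB P| ≥ 3M+2`. -/
theorem length_ge_of_far (M : ℕ) (m : List HexVertex) (hm : m ≠ []) (hc : m.IsChain hexGraph.Adj)
    (hhead : m.head hm = U M 0) (hlast : m.getLast hm = U (-(M : ℤ) - 1) 0)
    (hfar : ∀ P ∈ m, cA P = 0 → 3 * (M : ℤ) ^ 2 + 3 * M + 2 ≤ cB P ^ 2) :
    5 * M + 3 ≤ m.length := by
  obtain ⟨a, l, rfl⟩ := List.exists_cons_of_ne_nil hm
  simp only [List.head_cons] at hhead
  subst hhead
  -- a pivot on the imaginary axis
  obtain ⟨P, hPm, hP0⟩ := exists_cA_eq_zero l (U M 0) hc (by rw [cA_U]; omega)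
    (by rw [hlast, cA_U]; omega)
  have hPB := hfar P hPm hP0
  obtain ⟨s, t, hst⟩ := List.append_of_mem hPm
  -- the two sub-chains
  have hc1 : (s ++ [P]).IsChain hexGraph.Adj := by
    have : (U (M : ℤ) 0 :: l) = (s ++ [P]) ++ t := by rw [hst]; simp
    rw [this] at hc
    exact hc.left_of_append
  have hc2 : (P :: t).IsChain hexGraph.Adj := by
    rw [hst] at hc
    exact hc.right_of_append
  have hne1 : s ++ [P] ≠ [] := by simp
  have hhead1 : (s ++ [P]).head hne1 = U M 0 := by
    have h' : (U (M : ℤ) 0 :: l).head (List.cons_ne_nil _ _) = U M 0 := rfl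
    rw [← h']
    simp only [hst]
    cases s <;> rfl
  have hlast1 : (s ++ [P]).getLast hne1 = P := by simp
  have hlast2 : (P :: t).getLast (List.cons_ne_nil _ _) = U (-(M : ℤ) - 1) 0 := by
    rw [← hlast]
    simp only [hst]
    rw [List.getLast_append_of_ne_nil _ (List.cons_ne_nil _ _)]
  have hlen : (U (M : ℤ) 0 :: l).length = s.length + 1 + t.length := by
    rw [hst]; simp; omega
  rw [hlen]
  have hb0 : cB P ≠ 0 := by
    intro h; rw [h] at hPB; nlinarith
  rcases lt_or_gt_of_ne hb0 with hneg | hpos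
  · -- the chain passes BELOW the centre: `3cA + cB` first, then `3cA - cB`
    have h1 := chain_drop_le' (fun v => 3 * cA v + cB v) (fun _ _ => pB_step) (fun _ _ _ => pB_pair)
      (s ++ [P]) hne1 hc1
    have h2 := chain_drop_le' (fun v => 3 * cA v - cB v) (fun _ _ => pA_step) (fun _ _ _ => pA_pair)
      (P :: t) (List.cons_ne_nil _ _) hc2
    rw [hhead1, hlast1] at h1
    rw [List.head_cons, hlast2] at h2
    simp only [cA_U, cB_U, hP0, List.length_append, List.length_cons, List.length_nil] at h1 h2
    push_cast at h1 h2
    have hb : 3 * (M : ℤ) + 2 ≤ -2 * cB P := by nlinarith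
    omega
  · -- the chain passes ABOVE: `3cA - cB` first, then `3cA + cB`
    have h1 := chain_drop_le' (fun v => 3 * cA v - cB v) (fun _ _ => pA_step) (fun _ _ _ => pA_pair)
      (s ++ [P]) hne1 hc1
    have h2 := chain_drop_le' (fun v => 3 * cA v + cB v) (fun _ _ => pB_step) (fun _ _ _ => pB_pair)
      (P :: t) (List.cons_ne_nil _ _) hc2
    rw [hhead1, hlast1] at h1
    rw [List.head_cons, hlast2] at h2
    simp only [cA_U, cB_U, hP0, List.length_append, List.length_cons, List.length_nil] at h1 h2
    push_cast at h1 h2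
    have hb : 3 * (M : ℤ) + 2 ≤ 2 * cB P := by nlinarith
    omega

/-! ## Counting arcs from a door: at most `3^{n-1}` with `n` cells -/

/-- the three lattice neighbours of a face, listed -/
def nb (v : HexVertex) (t : Fin 3) : HexVertex :=
  if v.2 = 0 then ![D (v.1 0) (v.1 1), D (v.1 0 - 1) (v.1 1), D (v.1 0) (v.1 1 - 1)] t
  else ![U (v.1 0) (v.1 1), U (v.1 0 + 1) (v.1 1), U (v.1 0) (v.1 1 + 1)] t

/-- a lattice neighbour is one of the three listed ones -/
theorem exists_nb_eq {a b : HexVertex} (hab : hexGraph.Adj a b) : ∃ t : Fin 3, nb a t = b := by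
  obtain ⟨i, j, rfl | rfl⟩ := face_cases a
  · rcases adj_U_iff.1 hab with rfl | rfl | rfl
    · exact ⟨0, by simp [nb, U]⟩
    · exact ⟨1, by simp [nb, U]⟩
    · exact ⟨2, by simp [nb, U]⟩
  · rcases adj_D_iff.1 hab with rfl | rfl | rfl
    · exact ⟨0, by simp [nb, D]⟩
    · exact ⟨1, by simp [nb, D]⟩
    · exact ⟨2, by simp [nb, D]⟩

/-- index of a neighbour -/
def idx (a b : HexVertex) : Fin 3 :=
  if h : ∃ t : Fin 3, nb a t = b then Classical.choose h else 0

/-- the index recovers the neighbour -/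
theorem nb_idx {a b : HexVertex} (hab : hexGraph.Adj a b) : nb a (idx a b) = b := by
  have h := exists_nb_eq hab
  rw [idx, dif_pos h]
  exact Classical.choose_spec h

/-- the code of a chain: the list of neighbour indices of its steps -/
def code : List HexVertex → List (Fin 3)
  | a :: b :: l => idx a b :: code (b :: l)
  | _ => []

/-- rebuilding a chain from its first cell and its code -/
def decode : HexVertex → List (Fin 3) → List HexVertex
  | a, [] => [a]
  | a, t :: ts => a :: decode (nb a t) ts

/-- the code of a chain with `n+1` cells has length `n` -/
theorem length_code : ∀ (l : List HexVertex) (a : HexVertex), (code (a :: l)).length = l.length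
  | [], _ => rfl
  | b :: l, a => by simp [code, length_code l b]

/-- a lattice chain is determined by its first cell and its code -/
theorem decode_code : ∀ (l : List HexVertex) (a : HexVertex), (a :: l).IsChain hexGraph.Adj →
    decode a (code (a :: l)) = a :: l
  | [], a, _ => rfl
  | b :: l, a, hc => by
    have hab : hexGraph.Adj a b := (List.isChain_cons_cons.1 hc).1
    simp only [code, decode, nb_idx hab, decode_code l b (List.isChain_cons_cons.1 hc).2]


end Summit.CriticalPhenomena.SAWScalingLimit.Cruxes.HexTight.Negative.Subcritical

end
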